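import Summits.CriticalPhenomena.PercolationContinuityZ3.Theorems.Transplant.SkelNegBParamsRootCases
import Summits.CriticalPhenomena.PercolationContinuityZ3.Theorems.Transplant.SkelPhiRunExitGoals
import HarnessLib

/-!
# N1 params, chain of record `NegB`, part RootCasesT: THE ROOT RESIDUE's VALUES IN THE TWO TRANSPOSED BRIDGE CASES (NEG-SCOPE B.13: `o_b ≠ o_L`, steep
# `2|h_b| > ℓ_b` → `bridgeTrSide`; flat `2|h_b| ≤ ℓ_b` → `bridgeTrTop`) and the functional sizes of all three origins —
# `KS.yLd/qBd` (`d₀ := ⌊(2|h_b|+ℓ_b)/2⌋`, `d₁ := sgnz h_b·n_b`, `mh := ⌊ℓ_L/2⌋`, `qBd := RA′ + ⌊ℓ_b/2⌋ + 1`), `KS.yLt/qBt` (`d₀ := ℓ_b − 5`, `d₁ := 0`,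
# `mh := ⌊ℓ_L/2⌋`, `qBt := RA′ + |h_b| + 6`) with `hxa_d/hxb_d/hclr_d/four_qBd_le`, `hxa_t/hxb_t/hclr_t/four_qBt_le`, and **`Λ_s/Λ_d/Λ_t`**
# (`|Λ₀(yL)| ≤ 3m ∧ |Λ₁(yL)| ≤ 2m` for the three origins)

builds on p205010 (kernel theorem, internal audit signed; external expert review pending) — nothing in this file uses p205010; NOTHING is claimed about
the node `SamePDropOfSkeletonNeg₁` (OPEN).
Lane `prim-bschramm-*`, seat `prim-bschramm-stmt` (gen 14); helper file (`--supports stmt-CriticalPhenomena-4575 --as helper`); ledger HOME/prim-bschramm-stmt/NEG-PARAMS.md v0.13.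
[cite: KozmaNitzan2024, §4 p. 28 ((32) at the root), Lemma 10 Step IV] [cite: MartineauTassion2017, §3.2, §4.3]
-/

noncomputable section

open scoped Classical

namespace Summit.CriticalPhenomena.PercolationContinuityZ3.Theorems.Transplant

namespace PlanarSkeletonNeg

namespace NegB

open Literature.Probability.Percolation Literature.Probability.LatticeModels SimpleGraph
open SkelConc (Consts)
open Skelφ (shearUnit shearUnit_pos sgnz sgnz_cases)
open Skelφ.StepI (DataN)
open ChainPlanar (BridgePrm)
open TwoAxis.Para (modulus)
open Neg

namespace KS

/-! ## §1 The values -/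

section Defs

variable (κ : Consts) {V : Type} [DecidableEq V] [Countable V] {G : SimpleGraph V} [G.LocallyFinite] (Φ : PlanarSkeletonNeg G) (t : V)
  (p : unitInterval) (D : DataN V) (g f mk : ℕ)

/-- Along-displacement centre, steep transposed case: `⌊(2|h_b| + ℓ_b)/2⌋`. [this work] -/
def d0d : ℤ := (2 * |hBR κ Φ t p D mk| + ℓBR κ Φ t p D mk) / 2

/-- **The run origin, steep transposed case** (centre of `bridgeTrSide`'s core `1`). [this work] -/
def yLd (σ : ℤ) : Site 2 := yLof κ Φ t p D g f σ (d0d κ Φ t p D mk) (sgnz (hBR κ Φ t p D mk) * nBR κ Φ t p D mk) ((ℓL κ Φ t p D g f : ℤ) / 2)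

/-- **The start half-width, steep transposed case**: `RA′ + ⌊ℓ_b/2⌋ + 1`. [this work] -/
def qBd : ℕ := RA' κ Φ t p D mk + ℓBR κ Φ t p D mk / 2 + 1

/-- **The run origin, flat transposed case** (centre of `bridgeTrTop`'s core `1`: `d₀ := ℓ_b − 5`, `d₁ := 0`). [this work] -/
def yLt (σ : ℤ) : Site 2 := yLof κ Φ t p D g f σ ((ℓBR κ Φ t p D mk : ℤ) - 5) 0 ((ℓL κ Φ t p D g f : ℤ) / 2)

/-- **The start half-width, flat transposed case**: `RA′ + |h_b| + 6`. [this work] -/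
def qBt : ℕ := RA' κ Φ t p D mk + (hBR κ Φ t p D mk).natAbs + 6

/-- Core `1` of `bridgeTrSide` in coordinates. [folklore] -/
theorem mem_core1_side_iff (σ : ℤ) (x : Site 2) :
    x ∈ Finset.Icc (Skelφ.bridgeTrSide σ (nL κ Φ t p D g f) (hL κ Φ t p D g f) (ℓL κ Φ t p D g f) (RA' κ Φ t p D mk) (nBR κ Φ t p D mk) (hBR κ Φ t p D mk) (ℓBR κ Φ t p D mk)).core1Lo (Skelφ.bridgeTrSide σ (nL κ Φ t p D g f) (hL κ Φ t p D g f) (ℓL κ Φ t p D g f) (RA' κ Φ t p D mk) (nBR κ Φ t p D mk) (hBR κ Φ t p D mk) (ℓBR κ Φ t p D mk)).core1Hi ↔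
      ((nL κ Φ t p D g f : ℤ) - RA' κ Φ t p D mk + |hBR κ Φ t p D mk| ≤ x 0 ∧ x 0 ≤ (nL κ Φ t p D g f : ℤ) + RA' κ Φ t p D mk + (|hBR κ Φ t p D mk| + ℓBR κ Φ t p D mk)) ∧
        (σ * hL κ Φ t p D g f - RA' κ Φ t p D mk + σ * sgnz (hBR κ Φ t p D mk) * nBR κ Φ t p D mk ≤ x 1 ∧
          x 1 ≤ σ * hL κ Φ t p D g f + ℓL κ Φ t p D g f + RA' κ Φ t p D mk + σ * sgnz (hBR κ Φ t p D mk) * nBR κ Φ t p D mk) := by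
  have hlo : (Skelφ.bridgeTrSide σ (nL κ Φ t p D g f) (hL κ Φ t p D g f) (ℓL κ Φ t p D g f) (RA' κ Φ t p D mk) (nBR κ Φ t p D mk) (hBR κ Φ t p D mk) (ℓBR κ Φ t p D mk)).core1Lo =
      Skelφ.pt ((nL κ Φ t p D g f : ℤ) - RA' κ Φ t p D mk + |hBR κ Φ t p D mk|) (σ * hL κ Φ t p D g f - RA' κ Φ t p D mk + σ * sgnz (hBR κ Φ t p D mk) * nBR κ Φ t p D mk) := by
    funext i; unfold ChainPlanar.BridgePrm.core1Lo Skelφ.bridgeTrSide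
    fin_cases i <;> simp [Skelφ.pt]
  have hhi : (Skelφ.bridgeTrSide σ (nL κ Φ t p D g f) (hL κ Φ t p D g f) (ℓL κ Φ t p D g f) (RA' κ Φ t p D mk) (nBR κ Φ t p D mk) (hBR κ Φ t p D mk) (ℓBR κ Φ t p D mk)).core1Hi =
      Skelφ.pt ((nL κ Φ t p D g f : ℤ) + RA' κ Φ t p D mk + (|hBR κ Φ t p D mk| + ℓBR κ Φ t p D mk)) (σ * hL κ Φ t p D g f + ℓL κ Φ t p D g f + RA' κ Φ t p D mk + σ * sgnz (hBR κ Φ t p D mk) * nBR κ Φ t p D mk) := by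
    funext i; unfold ChainPlanar.BridgePrm.core1Hi Skelφ.bridgeTrSide
    fin_cases i <;> simp [Skelφ.pt]
  rw [hlo, hhi, Skelφ.mem_Icc_pt_iff]

/-- Core `1` of `bridgeTrTop` in coordinates. [folklore] -/
theorem mem_core1_top_iff (σ : ℤ) (x : Site 2) :
    x ∈ Finset.Icc (Skelφ.bridgeTrTop σ (nL κ Φ t p D g f) (hL κ Φ t p D g f) (ℓL κ Φ t p D g f) (RA' κ Φ t p D mk) (nBR κ Φ t p D mk) (hBR κ Φ t p D mk) (ℓBR κ Φ t p D mk)).core1Lo (Skelφ.bridgeTrTop σ (nL κ Φ t p D g f) (hL κ Φ t p D g f) (ℓL κ Φ t p D g f) (RA' κ Φ t p D mk) (nBR κ Φ t p D mk) (hBR κ Φ t p D mk) (ℓBR κ Φ t p D mk)).core1Hi ↔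
      ((nL κ Φ t p D g f : ℤ) - RA' κ Φ t p D mk + ((ℓBR κ Φ t p D mk : ℤ) - |hBR κ Φ t p D mk| - 11) ≤ x 0 ∧ x 0 ≤ (nL κ Φ t p D g f : ℤ) + RA' κ Φ t p D mk + ((ℓBR κ Φ t p D mk : ℤ) + |hBR κ Φ t p D mk|)) ∧
        (σ * hL κ Φ t p D g f - RA' κ Φ t p D mk + -(nBR κ Φ t p D mk : ℤ) ≤ x 1 ∧ x 1 ≤ σ * hL κ Φ t p D g f + ℓL κ Φ t p D g f + RA' κ Φ t p D mk + nBR κ Φ t p D mk) := by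
  have hlo : (Skelφ.bridgeTrTop σ (nL κ Φ t p D g f) (hL κ Φ t p D g f) (ℓL κ Φ t p D g f) (RA' κ Φ t p D mk) (nBR κ Φ t p D mk) (hBR κ Φ t p D mk) (ℓBR κ Φ t p D mk)).core1Lo =
      Skelφ.pt ((nL κ Φ t p D g f : ℤ) - RA' κ Φ t p D mk + ((ℓBR κ Φ t p D mk : ℤ) - |hBR κ Φ t p D mk| - 11)) (σ * hL κ Φ t p D g f - RA' κ Φ t p D mk + -(nBR κ Φ t p D mk : ℤ)) := by
    funext i; unfold ChainPlanar.BridgePrm.core1Lo Skelφ.bridgeTrTop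
    fin_cases i <;> simp [Skelφ.pt]
  have hhi : (Skelφ.bridgeTrTop σ (nL κ Φ t p D g f) (hL κ Φ t p D g f) (ℓL κ Φ t p D g f) (RA' κ Φ t p D mk) (nBR κ Φ t p D mk) (hBR κ Φ t p D mk) (ℓBR κ Φ t p D mk)).core1Hi =
      Skelφ.pt ((nL κ Φ t p D g f : ℤ) + RA' κ Φ t p D mk + ((ℓBR κ Φ t p D mk : ℤ) + |hBR κ Φ t p D mk|)) (σ * hL κ Φ t p D g f + ℓL κ Φ t p D g f + RA' κ Φ t p D mk + nBR κ Φ t p D mk) := by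
    funext i; unfold ChainPlanar.BridgePrm.core1Hi Skelφ.bridgeTrTop
    fin_cases i <;> simp [Skelφ.pt]
  rw [hlo, hhi, Skelφ.mem_Icc_pt_iff]

/-- **`hxa`, steep case.** [folklore] -/
theorem hxa_d {σ : ℤ} (hσ : σ = 1 ∨ σ = -1) :
    ∀ x ∈ Finset.Icc (Skelφ.bridgeTrSide σ (nL κ Φ t p D g f) (hL κ Φ t p D g f) (ℓL κ Φ t p D g f) (RA' κ Φ t p D mk) (nBR κ Φ t p D mk) (hBR κ Φ t p D mk) (ℓBR κ Φ t p D mk)).core1Lo (Skelφ.bridgeTrSide σ (nL κ Φ t p D g f) (hL κ Φ t p D g f) (ℓL κ Φ t p D g f) (RA' κ Φ t p D mk) (nBR κ Φ t p D mk) (hBR κ Φ t p D mk) (ℓBR κ Φ t p D mk)).core1Hi, |x 0 - σ * yLd κ Φ t p D g f mk σ 0| ≤ (qBd κ Φ t p D mk : ℤ) := by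
  intro x hx
  rw [mem_core1_side_iff] at hx
  have hσsq : σ * σ = 1 := by rcases hσ with h | h <;> simp [h]
  have e : σ * yLd κ Φ t p D g f mk σ 0 = (nL κ Φ t p D g f : ℤ) + d0d κ Φ t p D mk := by
    unfold yLd yLof; rw [Skelφ.pt_zero, ← mul_assoc, hσsq, one_mul]
  obtain ⟨d1, d2⟩ := RootArith.floor_sandwich (x := 2 * |hBR κ Φ t p D mk| + (ℓBR κ Φ t p D mk : ℤ)) (d := 2) (by norm_num)
  have ed : d0d κ Φ t p D mk = (2 * |hBR κ Φ t p D mk| + (ℓBR κ Φ t p D mk : ℤ)) / 2 := rfl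
  rw [← ed] at d1 d2
  have hq : (qBd κ Φ t p D mk : ℤ) = RA' κ Φ t p D mk + ((ℓBR κ Φ t p D mk / 2 : ℕ) : ℤ) + 1 := by unfold qBd; push_cast; ring
  have hl2 := Nat.lt_div_mul_add (a := ℓBR κ Φ t p D mk) (b := 2) (by norm_num)
  have hl2' : ((ℓBR κ Φ t p D mk : ℕ) : ℤ) < ((ℓBR κ Φ t p D mk / 2 : ℕ) : ℤ) * 2 + 2 := by exact_mod_cast hl2
  rw [e, hq, abs_le]; constructor <;> linarith [hx.1.1, hx.1.2]

/-- **`hxa`, flat case.** [folklore] -/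
theorem hxa_t {σ : ℤ} (hσ : σ = 1 ∨ σ = -1) :
    ∀ x ∈ Finset.Icc (Skelφ.bridgeTrTop σ (nL κ Φ t p D g f) (hL κ Φ t p D g f) (ℓL κ Φ t p D g f) (RA' κ Φ t p D mk) (nBR κ Φ t p D mk) (hBR κ Φ t p D mk) (ℓBR κ Φ t p D mk)).core1Lo (Skelφ.bridgeTrTop σ (nL κ Φ t p D g f) (hL κ Φ t p D g f) (ℓL κ Φ t p D g f) (RA' κ Φ t p D mk) (nBR κ Φ t p D mk) (hBR κ Φ t p D mk) (ℓBR κ Φ t p D mk)).core1Hi, |x 0 - σ * yLt κ Φ t p D g f mk σ 0| ≤ (qBt κ Φ t p D mk : ℤ) := by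
  intro x hx
  rw [mem_core1_top_iff] at hx
  have hσsq : σ * σ = 1 := by rcases hσ with h | h <;> simp [h]
  have e : σ * yLt κ Φ t p D g f mk σ 0 = (nL κ Φ t p D g f : ℤ) + ((ℓBR κ Φ t p D mk : ℤ) - 5) := by
    unfold yLt yLof; rw [Skelφ.pt_zero, ← mul_assoc, hσsq, one_mul]
  have hq : (qBt κ Φ t p D mk : ℤ) = RA' κ Φ t p D mk + |hBR κ Φ t p D mk| + 6 := by unfold qBt; push_cast [Int.natCast_natAbs]; ring
  rw [e, hq, abs_le]; constructor <;> linarith [hx.1.1, hx.1.2]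

/-- **`hclr`, steep case** (`2|h_b| > ℓ_b ≥ 2bR + 27` ⇒ `|h_b| ≥ bR + 14`). [folklore] -/
theorem hclr_d {σ : ℤ} (hσ : σ = 1 ∨ σ = -1) (hside : ℓBR κ Φ t p D mk < 2 * (hBR κ Φ t p D mk).natAbs) (hℓb : 2 * bR κ Φ t p D mk + 27 ≤ ℓBR κ Φ t p D mk) :
    (D.k : ℤ) < σ * yLd κ Φ t p D g f mk σ 0 - (qBd κ Φ t p D mk : ℤ) - RA' κ Φ t p D mk - nL κ Φ t p D g f := by
  have hσsq : σ * σ = 1 := by rcases hσ with h | h <;> simp [h]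
  have e : σ * yLd κ Φ t p D g f mk σ 0 = (nL κ Φ t p D g f : ℤ) + d0d κ Φ t p D mk := by
    unfold yLd yLof; rw [Skelφ.pt_zero, ← mul_assoc, hσsq, one_mul]
  obtain ⟨d1, d2⟩ := RootArith.floor_sandwich (x := 2 * |hBR κ Φ t p D mk| + (ℓBR κ Φ t p D mk : ℤ)) (d := 2) (by norm_num)
  have ed : d0d κ Φ t p D mk = (2 * |hBR κ Φ t p D mk| + (ℓBR κ Φ t p D mk : ℤ)) / 2 := rfl
  rw [← ed] at d1 d2
  have hq : (qBd κ Φ t p D mk : ℤ) = RA' κ Φ t p D mk + ((ℓBR κ Φ t p D mk / 2 : ℕ) : ℤ) + 1 := by unfold qBd; push_cast; ring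
  have hl2 : ((ℓBR κ Φ t p D mk / 2 : ℕ) : ℤ) * 2 ≤ (ℓBR κ Φ t p D mk : ℤ) := by exact_mod_cast Nat.div_mul_le_self (ℓBR κ Φ t p D mk) 2
  have h1 := (bR_eq κ Φ t p D mk).1
  have h2 : ((ℓBR κ Φ t p D mk : ℕ) : ℤ) < 2 * |hBR κ Φ t p D mk| := by rw [← Int.natCast_natAbs]; exact_mod_cast hside
  have h3 : ((2 * (D.k + 2 * RA' κ Φ t p D mk + 1) + 27 : ℕ) : ℤ) ≤ (ℓBR κ Φ t p D mk : ℤ) := by rw [← h1]; exact_mod_cast hℓb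
  push_cast at h3
  rw [e, hq]; linarith

/-- **`hclr`, flat case** (`2|h_b| ≤ ℓ_b`, `ℓ_b ≥ 2bR + 27`). [folklore] -/
theorem hclr_t {σ : ℤ} (hσ : σ = 1 ∨ σ = -1) (htop : 2 * (hBR κ Φ t p D mk).natAbs ≤ ℓBR κ Φ t p D mk) (hℓb : 2 * bR κ Φ t p D mk + 27 ≤ ℓBR κ Φ t p D mk) :
    (D.k : ℤ) < σ * yLt κ Φ t p D g f mk σ 0 - (qBt κ Φ t p D mk : ℤ) - RA' κ Φ t p D mk - nL κ Φ t p D g f := by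
  have hσsq : σ * σ = 1 := by rcases hσ with h | h <;> simp [h]
  have e : σ * yLt κ Φ t p D g f mk σ 0 = (nL κ Φ t p D g f : ℤ) + ((ℓBR κ Φ t p D mk : ℤ) - 5) := by
    unfold yLt yLof; rw [Skelφ.pt_zero, ← mul_assoc, hσsq, one_mul]
  have hq : (qBt κ Φ t p D mk : ℤ) = RA' κ Φ t p D mk + |hBR κ Φ t p D mk| + 6 := by unfold qBt; push_cast [Int.natCast_natAbs]; ring
  have h1 := (bR_eq κ Φ t p D mk).1
  have h2 : 2 * |hBR κ Φ t p D mk| ≤ (ℓBR κ Φ t p D mk : ℤ) := by rw [← Int.natCast_natAbs]; exact_mod_cast htop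
  have h3 : ((2 * (D.k + 2 * RA' κ Φ t p D mk + 1) + 27 : ℕ) : ℤ) ≤ (ℓBR κ Φ t p D mk : ℤ) := by rw [← h1]; exact_mod_cast hℓb
  push_cast at h3
  rw [e, hq]; linarith

end Defs

/-! ## §2 Facts at the floors (`g := gT`, `f := fT`) -/

section AtT

variable (κ : Consts) {V : Type} [DecidableEq V] [Countable V] {G : SimpleGraph V} [G.LocallyFinite] (Φ : PlanarSkeletonNeg G) (t : V)
  (p : unitInterval) (D : DataN V) (mk : ℕ) (gx fx : Neg.FSlot)

/-- `4·qBd ≤ n_L` and `4·qBt ≤ n_L` (`16(n_b+ℓ_b+|h_b|) ≤ M_L < n_L`, `2000(RA′+2) ≤ n_L`). [folklore] -/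
theorem four_qBdt_le : 4 * qBd κ Φ t p D mk ≤ nL κ Φ t p D (gT mk gx κ Φ t p D) (fT mk fx κ Φ t p D) ∧ 4 * qBt κ Φ t p D mk ≤ nL κ Φ t p D (gT mk gx κ Φ t p D) (fT mk fx κ Φ t p D) := by
  have h1 := (nL_floorsT κ Φ t p D mk fx (gT mk gx κ Φ t p D)).2.1
  have h2 := (ML_floorsT κ Φ t p D mk gx).2.2.1
  have h3 : ML κ Φ t p D (gT mk gx κ Φ t p D) + 1 ≤ nL κ Φ t p D (gT mk gx κ Φ t p D) (fT mk fx κ Φ t p D) := by have := (ML_lt_nL κ Φ t p D (gT mk gx κ Φ t p D) (fT mk fx κ Φ t p D)).1; omega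
  have h4 := Nat.div_le_self (ℓBR κ Φ t p D mk) 2
  unfold qBd qBt; constructor <;> omega

/-- **The functional sizes of the three origins**: `|Λ₀| ≤ 3m`, `|Λ₁| ≤ 2m` (the displacements are `≤ S`, the midpoints `≤ (ℓ_L + S)/2`; flat/steep need
`27 ≤ ℓ_b`). [folklore] -/
theorem Λ_sdt (hN : EqNumL κ Φ t p D (gT mk gx κ Φ t p D) (fT mk fx κ Φ t p D)) (hκ : (hL κ Φ t p D (gT mk gx κ Φ t p D) (fT mk fx κ Φ t p D)).natAbs ≤ 10 * nL κ Φ t p D (gT mk gx κ Φ t p D) (fT mk fx κ Φ t p D)) {σ : ℤ} (hσ : σ = 1 ∨ σ = -1)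
    (hℓb : 27 ≤ ℓBR κ Φ t p D mk) :
    (|Λ₀of κ Φ t p D (gT mk gx κ Φ t p D) (fT mk fx κ Φ t p D) (yLs κ Φ t p D (gT mk gx κ Φ t p D) (fT mk fx κ Φ t p D) mk σ)| ≤ 3 * modulus (nL κ Φ t p D (gT mk gx κ Φ t p D) (fT mk fx κ Φ t p D)) (hL κ Φ t p D (gT mk gx κ Φ t p D) (fT mk fx κ Φ t p D)) (vL κ Φ t p D (gT mk gx κ Φ t p D) (fT mk fx κ Φ t p D)) (Skelφ.NegPrm.vβOf (nL κ Φ t p D (gT mk gx κ Φ t p D) (fT mk fx κ Φ t p D)) (hL κ Φ t p D (gT mk gx κ Φ t p D) (fT mk fx κ Φ t p D)) (ℓL κ Φ t p D (gT mk gx κ Φ t p D) (fT mk fx κ Φ t p D)) (vL κ Φ t p D (gT mk gx κ Φ t p D) (fT mk fx κ Φ t p D))) ∧ |Λ₁of κ Φ t p D (gT mk gx κ Φ t p D) (fT mk fx κ Φ t p D) (yLs κ Φ t p D (gT mk gx κ Φ t p D) (fT mk fx κ Φ t p D) mk σ)| ≤ 2 * modulus (nL κ Φ t p D (gT mk gx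 κ Φ t p D) (fT mk fx κ Φ t p D)) (hL κ Φ t p D (gT mk gx κ Φ t p D) (fT mk fx κ Φ t p D)) (vL κ Φ t p D (gT mk gx κ Φ t p D) (fT mk fx κ Φ t p D)) (Skelφ.NegPrm.vβOf (nL κ Φ t p D (gT mk gx κ Φ t p D) (fT mk fx κ Φ t p D)) (hL κ Φ t p D (gT mk gx κ Φ t p D) (fT mk fx κ Φ t p D)) (ℓL κ Φ t p D (gT mk gx κ Φ t p D) (fT mk fx κ Φ t p D)) (vL κ Φ t p D (gT mk gx κ Φ t p D) (fT mk fx κ Φ t p D)))) ∧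
    (|Λ₀of κ Φ t p D (gT mk gx κ Φ t p D) (fT mk fx κ Φ t p D) (yLd κ Φ t p D (gT mk gx κ Φ t p D) (fT mk fx κ Φ t p D) mk σ)| ≤ 3 * modulus (nL κ Φ t p D (gT mk gx κ Φ t p D) (fT mk fx κ Φ t p D)) (hL κ Φ t p D (gT mk gx κ Φ t p D) (fT mk fx κ Φ t p D)) (vL κ Φ t p D (gT mk gx κ Φ t p D) (fT mk fx κ Φ t p D)) (Skelφ.NegPrm.vβOf (nL κ Φ t p D (gT mk gx κ Φ t p D) (fT mk fx κ Φ t p D)) (hL κ Φ t p D (gT mk gx κ Φ t p D) (fT mk fx κ Φ t p D)) (ℓL κ Φ t p D (gT mk gx κ Φ t p D) (fT mk fx κ Φ t p D)) (vL κ Φ t p D (gT mk gx κ Φ t p D) (fT mk fx κ Φ t p D))) ∧ |Λ₁of κ Φ t p D (gT mk gx κ Φ t p D) (fT mk fx κ Φ t p D) (yLd κ Φ t p D (gT mk gx κ Φ t p D) (fT mk fx κ Φ t p D) mk σ)| ≤ 2 * modulus (nL κ Φ t p D (gT mk gx κ Φ t p D) (fT mk fx κ Φ t p D)) (hL κ Φ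 t p D (gT mk gx κ Φ t p D) (fT mk fx κ Φ t p D)) (vL κ Φ t p D (gT mk gx κ Φ t p D) (fT mk fx κ Φ t p D)) (Skelφ.NegPrm.vβOf (nL κ Φ t p D (gT mk gx κ Φ t p D) (fT mk fx κ Φ t p D)) (hL κ Φ t p D (gT mk gx κ Φ t p D) (fT mk fx κ Φ t p D)) (ℓL κ Φ t p D (gT mk gx κ Φ t p D) (fT mk fx κ Φ t p D)) (vL κ Φ t p D (gT mk gx κ Φ t p D) (fT mk fx κ Φ t p D)))) ∧
    (|Λ₀of κ Φ t p D (gT mk gx κ Φ t p D) (fT mk fx κ Φ t p D) (yLt κ Φ t p D (gT mk gx κ Φ t p D) (fT mk fx κ Φ t p D) mk σ)| ≤ 3 * modulus (nL κ Φ t p D (gT mk gx κ Φ t p D) (fT mk fx κ Φ t p D)) (hL κ Φ t p D (gT mk gx κ Φ t p D) (fT mk fx κ Φ t p D)) (vL κ Φ t p D (gT mk gx κ Φ t p D) (fT mk fx κ Φ t p D)) (Skelφ.NegPrm.vβOf (nL κ Φ t p D (gT mk gx κ Φ t p D) (fT mk fx κ Φ t p D)) (hL κ Φ t p D (gT mk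 gx κ Φ t p D) (fT mk fx κ Φ t p D)) (ℓL κ Φ t p D (gT mk gx κ Φ t p D) (fT mk fx κ Φ t p D)) (vL κ Φ t p D (gT mk gx κ Φ t p D) (fT mk fx κ Φ t p D))) ∧ |Λ₁of κ Φ t p D (gT mk gx κ Φ t p D) (fT mk fx κ Φ t p D) (yLt κ Φ t p D (gT mk gx κ Φ t p D) (fT mk fx κ Φ t p D) mk σ)| ≤ 2 * modulus (nL κ Φ t p D (gT mk gx κ Φ t p D) (fT mk fx κ Φ t p D)) (hL κ Φ t p D (gT mk gx κ Φ t p D) (fT mk fx κ Φ t p D)) (vL κ Φ t p D (gT mk gx κ Φ t p D) (fT mk fx κ Φ t p D)) (Skelφ.NegPrm.vβOf (nL κ Φ t p D (gT mk gx κ Φ t p D) (fT mk fx κ Φ t p D)) (hL κ Φ t p D (gT mk gx κ Φ t p D) (fT mk fx κ Φ t p D)) (ℓL κ Φ t p D (gT mk gx κ Φ t p D) (fT mk fx κ Φ t p D)) (vL κ Φ t p D (gT mk gx κ Φ t p D) (fT mk fx κ Φ t p D)))) := by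
  have hS : (0 : ℤ) ≤ ((nBR κ Φ t p D mk + ℓBR κ Φ t p D mk + (hBR κ Φ t p D mk).natAbs : ℕ) : ℤ) := by positivity
  have eS : ((nBR κ Φ t p D mk + ℓBR κ Φ t p D mk + (hBR κ Φ t p D mk).natAbs : ℕ) : ℤ) = (nBR κ Φ t p D mk : ℤ) + ℓBR κ Φ t p D mk + |hBR κ Φ t p D mk| := by push_cast [Int.natCast_natAbs]; ring
  have hℓL : (0 : ℤ) ≤ (ℓL κ Φ t p D (gT mk gx κ Φ t p D) (fT mk fx κ Φ t p D) : ℤ) := by positivity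
  have hℓb' : (27 : ℤ) ≤ ℓBR κ Φ t p D mk := by exact_mod_cast hℓb
  obtain ⟨l1, l2⟩ := RootArith.floor_sandwich (x := (ℓL κ Φ t p D (gT mk gx κ Φ t p D) (fT mk fx κ Φ t p D) : ℤ)) (d := 2) (by norm_num)
  refine ⟨?_, ?_, ?_⟩
  · -- same: d₀ = n_b, d₁ = h_b, mh = ⌊(ℓ_L+ℓ_b)/2⌋
    obtain ⟨m1, m2⟩ := RootArith.floor_sandwich (x := (ℓL κ Φ t p D (gT mk gx κ Φ t p D) (fT mk fx κ Φ t p D) : ℤ) + ℓBR κ Φ t p D mk) (d := 2) (by norm_num)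
    refine abs_Λof_yLof_le κ Φ t p D mk gx (fT mk fx κ Φ t p D) hN hκ hσ ?_ ?_ ?_ ?_
    · rw [eS, Nat.abs_cast]; linarith [abs_nonneg (hBR κ Φ t p D mk)]
    · rw [eS]; linarith
    · show (0 : ℤ) ≤ mhs κ Φ t p D (gT mk gx κ Φ t p D) (fT mk fx κ Φ t p D) mk; unfold mhs; omega
    · show 2 * mhs κ Φ t p D (gT mk gx κ Φ t p D) (fT mk fx κ Φ t p D) mk ≤ _; unfold mhs; rw [eS]; linarith [abs_nonneg (hBR κ Φ t p D mk)]
  · -- steep: d₀ = ⌊(2|h_b|+ℓ_b)/2⌋, d₁ = sgnz h_b · n_b, mh = ⌊ℓ_L/2⌋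
    obtain ⟨d1, d2⟩ := RootArith.floor_sandwich (x := 2 * |hBR κ Φ t p D mk| + (ℓBR κ Φ t p D mk : ℤ)) (d := 2) (by norm_num)
    have hs : |sgnz (hBR κ Φ t p D mk)| = 1 := by rcases sgnz_cases (hBR κ Φ t p D mk) with h | h <;> simp [h]
    refine abs_Λof_yLof_le κ Φ t p D mk gx (fT mk fx κ Φ t p D) hN hκ hσ ?_ ?_ ?_ ?_
    · show |d0d κ Φ t p D mk| ≤ _
      unfold d0d; rw [eS, abs_le]; constructor <;> linarith [abs_nonneg (hBR κ Φ t p D mk)]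
    · rw [abs_mul, hs, one_mul, Nat.abs_cast, eS]; linarith [abs_nonneg (hBR κ Φ t p D mk)]
    · omega
    · linarith
  · -- flat: d₀ = ℓ_b − 5, d₁ = 0, mh = ⌊ℓ_L/2⌋
    refine abs_Λof_yLof_le κ Φ t p D mk gx (fT mk fx κ Φ t p D) hN hκ hσ ?_ ?_ ?_ ?_
    · rw [eS, abs_le]; constructor <;> linarith [abs_nonneg (hBR κ Φ t p D mk)]
    · simp only [abs_zero]; exact hS
    · omega
    · linarith

/-- **`hxb`, steep case** (`22RA′ + 10ℓ_b + 43 ≤ ℓ_L`). [folklore] -/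
theorem hxb_d (hN : EqNumL κ Φ t p D (gT mk gx κ Φ t p D) (fT mk fx κ Φ t p D)) (hκ : (hL κ Φ t p D (gT mk gx κ Φ t p D) (fT mk fx κ Φ t p D)).natAbs ≤ 10 * nL κ Φ t p D (gT mk gx κ Φ t p D) (fT mk fx κ Φ t p D)) {σ : ℤ} (hσ : σ = 1 ∨ σ = -1) :
    ∀ x ∈ Finset.Icc (Skelφ.bridgeTrSide σ (nL κ Φ t p D (gT mk gx κ Φ t p D) (fT mk fx κ Φ t p D)) (hL κ Φ t p D (gT mk gx κ Φ t p D) (fT mk fx κ Φ t p D)) (ℓL κ Φ t p D (gT mk gx κ Φ t p D) (fT mk fx κ Φ t p D)) (RA' κ Φ t p D mk) (nBR κ Φ t p D mk) (hBR κ Φ t p D mk) (ℓBR κ Φ t p D mk)).core1Lo (Skelφ.bridgeTrSide σ (nL κ Φ t p D (gT mk gx κ Φ t p D) (fT mk fx κ Φ t p D)) (hL κ Φ t p D (gT mk gx κ Φ t p D) (fT mk fx κ Φ t p D)) (ℓL κ Φ t p D (gT mk gx κ Φ t p D) (fT mk fx κ Φ t p D)) (RA' κ Φ t p D mk) (nBR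 κ Φ t p D mk) (hBR κ Φ t p D mk) (ℓBR κ Φ t p D mk)).core1Hi,
      |σ * ((nL κ Φ t p D (gT mk gx κ Φ t p D) (fT mk fx κ Φ t p D) : ℤ) * (x 1 - yLd κ Φ t p D (gT mk gx κ Φ t p D) (fT mk fx κ Φ t p D) mk σ 1) - hL κ Φ t p D (gT mk gx κ Φ t p D) (fT mk fx κ Φ t p D) * (σ * x 0 - yLd κ Φ t p D (gT mk gx κ Φ t p D) (fT mk fx κ Φ t p D) mk σ 0))| + (shearUnit (nL κ Φ t p D (gT mk gx κ Φ t p D) (fT mk fx κ Φ t p D)) (hL κ Φ t p D (gT mk gx κ Φ t p D) (fT mk fx κ Φ t p D)) : ℤ) ≤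
        ((nL κ Φ t p D (gT mk gx κ Φ t p D) (fT mk fx κ Φ t p D) * ℓL κ Φ t p D (gT mk gx κ Φ t p D) (fT mk fx κ Φ t p D) / shearUnit (nL κ Φ t p D (gT mk gx κ Φ t p D) (fT mk fx κ Φ t p D)) (hL κ Φ t p D (gT mk gx κ Φ t p D) (fT mk fx κ Φ t p D)) + 1 : ℕ) : ℤ) * (shearUnit (nL κ Φ t p D (gT mk gx κ Φ t p D) (fT mk fx κ Φ t p D)) (hL κ Φ t p D (gT mk gx κ Φ t p D) (fT mk fx κ Φ t p D)) : ℤ) := by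
  intro x hx
  rw [mem_core1_side_iff] at hx
  obtain ⟨⟨h0l, h0u⟩, ⟨h1l, h1u⟩⟩ := hx
  obtain ⟨hn1, hℓ1⟩ := one_le_of_eqNumL κ Φ t p D _ _ hN
  have hσabs : |σ| = 1 := by rcases hσ with h | h <;> simp [h]
  -- the floor
  have hfl : 22 * (RA' κ Φ t p D mk : ℤ) + 10 * ℓBR κ Φ t p D mk + 43 ≤ ℓL κ Φ t p D (gT mk gx κ Φ t p D) (fT mk fx κ Φ t p D) := by
    have h3 := (ML_floorsT κ Φ t p D mk gx).2.2.1
    have h4 := (ML_floorsT κ Φ t p D mk gx).2.1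
    have h5 := hN.ℓ_le
    have h6 : ((22 * RA' κ Φ t p D mk + 10 * ℓBR κ Φ t p D mk + 43 : ℕ) : ℤ) ≤ (ML κ Φ t p D (gT mk gx κ Φ t p D) : ℤ) := by
      exact_mod_cast (by omega : 22 * RA' κ Φ t p D mk + 10 * ℓBR κ Φ t p D mk + 43 ≤ ML κ Φ t p D (gT mk gx κ Φ t p D))
    push_cast at h6; linarith
  have e0 : σ * x 0 - yLd κ Φ t p D (gT mk gx κ Φ t p D) (fT mk fx κ Φ t p D) mk σ 0 = σ * (x 0 - ((nL κ Φ t p D (gT mk gx κ Φ t p D) (fT mk fx κ Φ t p D) : ℤ) + d0d κ Φ t p D mk)) := by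
    unfold yLd yLof; rw [Skelφ.pt_zero]; ring
  have e1 : yLd κ Φ t p D (gT mk gx κ Φ t p D) (fT mk fx κ Φ t p D) mk σ 1 = σ * (hL κ Φ t p D (gT mk gx κ Φ t p D) (fT mk fx κ Φ t p D) + sgnz (hBR κ Φ t p D mk) * nBR κ Φ t p D mk) + (ℓL κ Φ t p D (gT mk gx κ Φ t p D) (fT mk fx κ Φ t p D) : ℤ) / 2 := by
    unfold yLd yLof; rw [Skelφ.pt_one]
  obtain ⟨l1, l2⟩ := RootArith.floor_sandwich (x := (ℓL κ Φ t p D (gT mk gx κ Φ t p D) (fT mk fx κ Φ t p D) : ℤ)) (d := 2) (by norm_num)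
  obtain ⟨d1, d2⟩ := RootArith.floor_sandwich (x := 2 * |hBR κ Φ t p D mk| + (ℓBR κ Φ t p D mk : ℤ)) (d := 2) (by norm_num)
  have ed : d0d κ Φ t p D mk = (2 * |hBR κ Φ t p D mk| + (ℓBR κ Φ t p D mk : ℤ)) / 2 := rfl
  rw [← ed] at d1 d2
  have hq : (qBd κ Φ t p D mk : ℤ) = RA' κ Φ t p D mk + ((ℓBR κ Φ t p D mk / 2 : ℕ) : ℤ) + 1 := by unfold qBd; push_cast; ring
  have hl2' : ((ℓBR κ Φ t p D mk : ℕ) : ℤ) < ((ℓBR κ Φ t p D mk / 2 : ℕ) : ℤ) * 2 + 2 := by exact_mod_cast Nat.lt_div_mul_add (a := ℓBR κ Φ t p D mk) (b := 2) (by norm_num)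
  have hl2 : ((ℓBR κ Φ t p D mk / 2 : ℕ) : ℤ) * 2 ≤ (ℓBR κ Φ t p D mk : ℤ) := by exact_mod_cast Nat.div_mul_le_self (ℓBR κ Φ t p D mk) 2
  set a := x 1 - yLd κ Φ t p D (gT mk gx κ Φ t p D) (fT mk fx κ Φ t p D) mk σ 1 with ha
  set b := x 0 - ((nL κ Φ t p D (gT mk gx κ Φ t p D) (fT mk fx κ Φ t p D) : ℤ) + d0d κ Φ t p D mk) with hb
  set T2 := (ℓL κ Φ t p D (gT mk gx κ Φ t p D) (fT mk fx κ Φ t p D) : ℤ) + 2 * RA' κ Φ t p D mk + 1 with hT2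
  set Q := (RA' κ Φ t p D mk : ℤ) + ℓBR κ Φ t p D mk / 2 + 1 with hQ
  have hQ' : (ℓBR κ Φ t p D mk : ℤ) / 2 ≤ ((ℓBR κ Φ t p D mk / 2 : ℕ) : ℤ) + 0 := by omega
  have hb' : |b| ≤ Q := abs_le.2 ⟨by omega, by omega⟩
  have ha' : |2 * a| ≤ T2 := by rw [ha, e1, hT2, abs_le]; constructor <;> linarith
  have hfl : (2 * RA' κ Φ t p D mk + 1 : ℤ) + 20 * Q + 22 ≤ ℓL κ Φ t p D (gT mk gx κ Φ t p D) (fT mk fx κ Φ t p D) := by rw [hQ]; omega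
  rw [e0]
  have hU : (shearUnit (nL κ Φ t p D (gT mk gx κ Φ t p D) (fT mk fx κ Φ t p D)) (hL κ Φ t p D (gT mk gx κ Φ t p D) (fT mk fx κ Φ t p D)) : ℤ) ≤ 11 * (nL κ Φ t p D (gT mk gx κ Φ t p D) (fT mk fx κ Φ t p D) : ℤ) := by
    have h10 : ((hL κ Φ t p D (gT mk gx κ Φ t p D) (fT mk fx κ Φ t p D)).natAbs : ℤ) ≤ 10 * (nL κ Φ t p D (gT mk gx κ Φ t p D) (fT mk fx κ Φ t p D) : ℤ) := by exact_mod_cast hκ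
    unfold Skelφ.shearUnit; simp only [Nat.cast_add]; linarith
  have hκ' : |hL κ Φ t p D (gT mk gx κ Φ t p D) (fT mk fx κ Φ t p D)| ≤ 10 * (nL κ Φ t p D (gT mk gx κ Φ t p D) (fT mk fx κ Φ t p D) : ℤ) := by rw [← Int.natCast_natAbs]; exact_mod_cast hκ
  have key : |σ * ((nL κ Φ t p D (gT mk gx κ Φ t p D) (fT mk fx κ Φ t p D) : ℤ) * a - hL κ Φ t p D (gT mk gx κ Φ t p D) (fT mk fx κ Φ t p D) * (σ * b))| ≤ (nL κ Φ t p D (gT mk gx κ Φ t p D) (fT mk fx κ Φ t p D) : ℤ) * |a| + |hL κ Φ t p D (gT mk gx κ Φ t p D) (fT mk fx κ Φ t p D)| * |b| := by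
    rw [abs_mul, hσabs, one_mul]
    calc |(nL κ Φ t p D (gT mk gx κ Φ t p D) (fT mk fx κ Φ t p D) : ℤ) * a - hL κ Φ t p D (gT mk gx κ Φ t p D) (fT mk fx κ Φ t p D) * (σ * b)| ≤ |(nL κ Φ t p D (gT mk gx κ Φ t p D) (fT mk fx κ Φ t p D) : ℤ) * a| + |hL κ Φ t p D (gT mk gx κ Φ t p D) (fT mk fx κ Φ t p D) * (σ * b)| := abs_sub _ _
      _ = (nL κ Φ t p D (gT mk gx κ Φ t p D) (fT mk fx κ Φ t p D) : ℤ) * |a| + |hL κ Φ t p D (gT mk gx κ Φ t p D) (fT mk fx κ Φ t p D)| * |b| := by rw [abs_mul, abs_mul, abs_mul, hσabs, one_mul, Nat.abs_cast]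
  have hn0 : (0 : ℤ) ≤ nL κ Φ t p D (gT mk gx κ Φ t p D) (fT mk fx κ Φ t p D) := by positivity
  have h2a : 2 * ((nL κ Φ t p D (gT mk gx κ Φ t p D) (fT mk fx κ Φ t p D) : ℤ) * |a|) ≤ (nL κ Φ t p D (gT mk gx κ Φ t p D) (fT mk fx κ Φ t p D) : ℤ) * T2 := by
    have : (nL κ Φ t p D (gT mk gx κ Φ t p D) (fT mk fx κ Φ t p D) : ℤ) * |2 * a| ≤ (nL κ Φ t p D (gT mk gx κ Φ t p D) (fT mk fx κ Φ t p D) : ℤ) * T2 := mul_le_mul_of_nonneg_left ha' hn0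
    rw [abs_mul, show |(2:ℤ)| = 2 by norm_num] at this; linarith
  have h2b : |hL κ Φ t p D (gT mk gx κ Φ t p D) (fT mk fx κ Φ t p D)| * |b| ≤ 10 * (nL κ Φ t p D (gT mk gx κ Φ t p D) (fT mk fx κ Φ t p D) : ℤ) * Q := mul_le_mul hκ' hb' (abs_nonneg _) (by positivity)
  have hfl' := mul_le_mul_of_nonneg_left hfl hn0
  have hUpos : 0 < shearUnit (nL κ Φ t p D (gT mk gx κ Φ t p D) (fT mk fx κ Φ t p D)) (hL κ Φ t p D (gT mk gx κ Φ t p D) (fT mk fx κ Φ t p D)) := by unfold Skelφ.shearUnit; omega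
  have hWlo : (nL κ Φ t p D (gT mk gx κ Φ t p D) (fT mk fx κ Φ t p D) : ℤ) * ℓL κ Φ t p D (gT mk gx κ Φ t p D) (fT mk fx κ Φ t p D) + 1 ≤ ((nL κ Φ t p D (gT mk gx κ Φ t p D) (fT mk fx κ Φ t p D) * ℓL κ Φ t p D (gT mk gx κ Φ t p D) (fT mk fx κ Φ t p D) / shearUnit (nL κ Φ t p D (gT mk gx κ Φ t p D) (fT mk fx κ Φ t p D)) (hL κ Φ t p D (gT mk gx κ Φ t p D) (fT mk fx κ Φ t p D)) + 1 : ℕ) : ℤ) * (shearUnit (nL κ Φ t p D (gT mk gx κ Φ t p D) (fT mk fx κ Φ t p D)) (hL κ Φ t p D (gT mk gx κ Φ t p D) (fT mk fx κ Φ t p D)) : ℤ) := by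
    have hWlo' := Nat.lt_div_mul_add (a := nL κ Φ t p D (gT mk gx κ Φ t p D) (fT mk fx κ Φ t p D) * ℓL κ Φ t p D (gT mk gx κ Φ t p D) (fT mk fx κ Φ t p D)) hUpos
    have h' : nL κ Φ t p D (gT mk gx κ Φ t p D) (fT mk fx κ Φ t p D) * ℓL κ Φ t p D (gT mk gx κ Φ t p D) (fT mk fx κ Φ t p D) + 1 ≤ (nL κ Φ t p D (gT mk gx κ Φ t p D) (fT mk fx κ Φ t p D) * ℓL κ Φ t p D (gT mk gx κ Φ t p D) (fT mk fx κ Φ t p D) / shearUnit (nL κ Φ t p D (gT mk gx κ Φ t p D) (fT mk fx κ Φ t p D)) (hL κ Φ t p D (gT mk gx κ Φ t p D) (fT mk fx κ Φ t p D)) + 1) * shearUnit (nL κ Φ t p D (gT mk gx κ Φ t p D) (fT mk fx κ Φ t p D)) (hL κ Φ t p D (gT mk gx κ Φ t p D) (fT mk fx κ Φ t p D)) := by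
      rw [Nat.add_mul, one_mul]; omega
    exact_mod_cast h'
  have hab := abs_nonneg (σ * ((nL κ Φ t p D (gT mk gx κ Φ t p D) (fT mk fx κ Φ t p D) : ℤ) * a - hL κ Φ t p D (gT mk gx κ Φ t p D) (fT mk fx κ Φ t p D) * (σ * b)))
  linarith [key, h2a, h2b, hU, hfl', hWlo, abs_nonneg a]

/-- **`hxb`, flat case** (`22RA′ + 2n_b + 20|h_b| + 143 ≤ ℓ_L`, using `2|h_b| ≤ ℓ_b`). [folklore] -/
theorem hxb_t (hN : EqNumL κ Φ t p D (gT mk gx κ Φ t p D) (fT mk fx κ Φ t p D)) (hκ : (hL κ Φ t p D (gT mk gx κ Φ t p D) (fT mk fx κ Φ t p D)).natAbs ≤ 10 * nL κ Φ t p D (gT mk gx κ Φ t p D) (fT mk fx κ Φ t p D)) {σ : ℤ} (hσ : σ = 1 ∨ σ = -1)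
    (htop : 2 * (hBR κ Φ t p D mk).natAbs ≤ ℓBR κ Φ t p D mk) :
    ∀ x ∈ Finset.Icc (Skelφ.bridgeTrTop σ (nL κ Φ t p D (gT mk gx κ Φ t p D) (fT mk fx κ Φ t p D)) (hL κ Φ t p D (gT mk gx κ Φ t p D) (fT mk fx κ Φ t p D)) (ℓL κ Φ t p D (gT mk gx κ Φ t p D) (fT mk fx κ Φ t p D)) (RA' κ Φ t p D mk) (nBR κ Φ t p D mk) (hBR κ Φ t p D mk) (ℓBR κ Φ t p D mk)).core1Lo (Skelφ.bridgeTrTop σ (nL κ Φ t p D (gT mk gx κ Φ t p D) (fT mk fx κ Φ t p D)) (hL κ Φ t p D (gT mk gx κ Φ t p D) (fT mk fx κ Φ t p D)) (ℓL κ Φ t p D (gT mk gx κ Φ t p D) (fT mk fx κ Φ t p D)) (RA' κ Φ t p D mk) (nBR κ Φ t p D mk) (hBR κ Φ t p D mk) (ℓBR κ Φ t p D mk)).core1Hi,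
      |σ * ((nL κ Φ t p D (gT mk gx κ Φ t p D) (fT mk fx κ Φ t p D) : ℤ) * (x 1 - yLt κ Φ t p D (gT mk gx κ Φ t p D) (fT mk fx κ Φ t p D) mk σ 1) - hL κ Φ t p D (gT mk gx κ Φ t p D) (fT mk fx κ Φ t p D) * (σ * x 0 - yLt κ Φ t p D (gT mk gx κ Φ t p D) (fT mk fx κ Φ t p D) mk σ 0))| + (shearUnit (nL κ Φ t p D (gT mk gx κ Φ t p D) (fT mk fx κ Φ t p D)) (hL κ Φ t p D (gT mk gx κ Φ t p D) (fT mk fx κ Φ t p D)) : ℤ) ≤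
        ((nL κ Φ t p D (gT mk gx κ Φ t p D) (fT mk fx κ Φ t p D) * ℓL κ Φ t p D (gT mk gx κ Φ t p D) (fT mk fx κ Φ t p D) / shearUnit (nL κ Φ t p D (gT mk gx κ Φ t p D) (fT mk fx κ Φ t p D)) (hL κ Φ t p D (gT mk gx κ Φ t p D) (fT mk fx κ Φ t p D)) + 1 : ℕ) : ℤ) * (shearUnit (nL κ Φ t p D (gT mk gx κ Φ t p D) (fT mk fx κ Φ t p D)) (hL κ Φ t p D (gT mk gx κ Φ t p D) (fT mk fx κ Φ t p D)) : ℤ) := by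
  intro x hx
  rw [mem_core1_top_iff] at hx
  obtain ⟨⟨h0l, h0u⟩, ⟨h1l, h1u⟩⟩ := hx
  obtain ⟨hn1, hℓ1⟩ := one_le_of_eqNumL κ Φ t p D _ _ hN
  have hσabs : |σ| = 1 := by rcases hσ with h | h <;> simp [h]
  have htop' : 2 * |hBR κ Φ t p D mk| ≤ (ℓBR κ Φ t p D mk : ℤ) := by rw [← Int.natCast_natAbs]; exact_mod_cast htop
  have hfl : 22 * (RA' κ Φ t p D mk : ℤ) + 2 * nBR κ Φ t p D mk + 20 * |hBR κ Φ t p D mk| + 143 ≤ ℓL κ Φ t p D (gT mk gx κ Φ t p D) (fT mk fx κ Φ t p D) := by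
    have h3 := (ML_floorsT κ Φ t p D mk gx).2.2.1
    have h4 := (ML_floorsT κ Φ t p D mk gx).2.1
    have h5 := hN.ℓ_le
    have h6 : ((22 * RA' κ Φ t p D mk + 2 * nBR κ Φ t p D mk + 10 * ℓBR κ Φ t p D mk + 143 : ℕ) : ℤ) ≤ (ML κ Φ t p D (gT mk gx κ Φ t p D) : ℤ) := by
      exact_mod_cast (by omega : 22 * RA' κ Φ t p D mk + 2 * nBR κ Φ t p D mk + 10 * ℓBR κ Φ t p D mk + 143 ≤ ML κ Φ t p D (gT mk gx κ Φ t p D))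
    push_cast at h6; linarith
  have e0 : σ * x 0 - yLt κ Φ t p D (gT mk gx κ Φ t p D) (fT mk fx κ Φ t p D) mk σ 0 = σ * (x 0 - ((nL κ Φ t p D (gT mk gx κ Φ t p D) (fT mk fx κ Φ t p D) : ℤ) + ((ℓBR κ Φ t p D mk : ℤ) - 5))) := by
    unfold yLt yLof; rw [Skelφ.pt_zero]; ring
  have e1 : yLt κ Φ t p D (gT mk gx κ Φ t p D) (fT mk fx κ Φ t p D) mk σ 1 = σ * (hL κ Φ t p D (gT mk gx κ Φ t p D) (fT mk fx κ Φ t p D) + 0) + (ℓL κ Φ t p D (gT mk gx κ Φ t p D) (fT mk fx κ Φ t p D) : ℤ) / 2 := by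
    unfold yLt yLof; rw [Skelφ.pt_one]
  obtain ⟨l1, l2⟩ := RootArith.floor_sandwich (x := (ℓL κ Φ t p D (gT mk gx κ Φ t p D) (fT mk fx κ Φ t p D) : ℤ)) (d := 2) (by norm_num)
  have hq : (qBt κ Φ t p D mk : ℤ) = RA' κ Φ t p D mk + |hBR κ Φ t p D mk| + 6 := by unfold qBt; push_cast [Int.natCast_natAbs]; ring
  set a := x 1 - yLt κ Φ t p D (gT mk gx κ Φ t p D) (fT mk fx κ Φ t p D) mk σ 1 with ha
  set b := x 0 - ((nL κ Φ t p D (gT mk gx κ Φ t p D) (fT mk fx κ Φ t p D) : ℤ) + ((ℓBR κ Φ t p D mk : ℤ) - 5)) with hb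
  set T2 := (ℓL κ Φ t p D (gT mk gx κ Φ t p D) (fT mk fx κ Φ t p D) : ℤ) + 2 * RA' κ Φ t p D mk + 2 * nBR κ Φ t p D mk + 1 with hT2
  set Q := (RA' κ Φ t p D mk : ℤ) + |hBR κ Φ t p D mk| + 6 with hQ
  have hb' : |b| ≤ Q := abs_le.2 ⟨by rw [hb, hQ]; linarith, by rw [hb, hQ]; linarith⟩
  have ha' : |2 * a| ≤ T2 := by rw [ha, e1, hT2, abs_le]; constructor <;> linarith
  have hfl : (2 * RA' κ Φ t p D mk + 2 * nBR κ Φ t p D mk + 1 : ℤ) + 20 * Q + 22 ≤ ℓL κ Φ t p D (gT mk gx κ Φ t p D) (fT mk fx κ Φ t p D) := by rw [hQ]; linarith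
  rw [e0]
  have hU : (shearUnit (nL κ Φ t p D (gT mk gx κ Φ t p D) (fT mk fx κ Φ t p D)) (hL κ Φ t p D (gT mk gx κ Φ t p D) (fT mk fx κ Φ t p D)) : ℤ) ≤ 11 * (nL κ Φ t p D (gT mk gx κ Φ t p D) (fT mk fx κ Φ t p D) : ℤ) := by
    have h10 : ((hL κ Φ t p D (gT mk gx κ Φ t p D) (fT mk fx κ Φ t p D)).natAbs : ℤ) ≤ 10 * (nL κ Φ t p D (gT mk gx κ Φ t p D) (fT mk fx κ Φ t p D) : ℤ) := by exact_mod_cast hκ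
    unfold Skelφ.shearUnit; simp only [Nat.cast_add]; linarith
  have hκ' : |hL κ Φ t p D (gT mk gx κ Φ t p D) (fT mk fx κ Φ t p D)| ≤ 10 * (nL κ Φ t p D (gT mk gx κ Φ t p D) (fT mk fx κ Φ t p D) : ℤ) := by rw [← Int.natCast_natAbs]; exact_mod_cast hκ
  have key : |σ * ((nL κ Φ t p D (gT mk gx κ Φ t p D) (fT mk fx κ Φ t p D) : ℤ) * a - hL κ Φ t p D (gT mk gx κ Φ t p D) (fT mk fx κ Φ t p D) * (σ * b))| ≤ (nL κ Φ t p D (gT mk gx κ Φ t p D) (fT mk fx κ Φ t p D) : ℤ) * |a| + |hL κ Φ t p D (gT mk gx κ Φ t p D) (fT mk fx κ Φ t p D)| * |b| := by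
    rw [abs_mul, hσabs, one_mul]
    calc |(nL κ Φ t p D (gT mk gx κ Φ t p D) (fT mk fx κ Φ t p D) : ℤ) * a - hL κ Φ t p D (gT mk gx κ Φ t p D) (fT mk fx κ Φ t p D) * (σ * b)| ≤ |(nL κ Φ t p D (gT mk gx κ Φ t p D) (fT mk fx κ Φ t p D) : ℤ) * a| + |hL κ Φ t p D (gT mk gx κ Φ t p D) (fT mk fx κ Φ t p D) * (σ * b)| := abs_sub _ _
      _ = (nL κ Φ t p D (gT mk gx κ Φ t p D) (fT mk fx κ Φ t p D) : ℤ) * |a| + |hL κ Φ t p D (gT mk gx κ Φ t p D) (fT mk fx κ Φ t p D)| * |b| := by rw [abs_mul, abs_mul, abs_mul, hσabs, one_mul, Nat.abs_cast]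
  have hn0 : (0 : ℤ) ≤ nL κ Φ t p D (gT mk gx κ Φ t p D) (fT mk fx κ Φ t p D) := by positivity
  have h2a : 2 * ((nL κ Φ t p D (gT mk gx κ Φ t p D) (fT mk fx κ Φ t p D) : ℤ) * |a|) ≤ (nL κ Φ t p D (gT mk gx κ Φ t p D) (fT mk fx κ Φ t p D) : ℤ) * T2 := by
    have : (nL κ Φ t p D (gT mk gx κ Φ t p D) (fT mk fx κ Φ t p D) : ℤ) * |2 * a| ≤ (nL κ Φ t p D (gT mk gx κ Φ t p D) (fT mk fx κ Φ t p D) : ℤ) * T2 := mul_le_mul_of_nonneg_left ha' hn0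
    rw [abs_mul, show |(2:ℤ)| = 2 by norm_num] at this; linarith
  have h2b : |hL κ Φ t p D (gT mk gx κ Φ t p D) (fT mk fx κ Φ t p D)| * |b| ≤ 10 * (nL κ Φ t p D (gT mk gx κ Φ t p D) (fT mk fx κ Φ t p D) : ℤ) * Q := mul_le_mul hκ' hb' (abs_nonneg _) (by positivity)
  have hfl' := mul_le_mul_of_nonneg_left hfl hn0
  have hUpos : 0 < shearUnit (nL κ Φ t p D (gT mk gx κ Φ t p D) (fT mk fx κ Φ t p D)) (hL κ Φ t p D (gT mk gx κ Φ t p D) (fT mk fx κ Φ t p D)) := by unfold Skelφ.shearUnit; omega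
  have hWlo : (nL κ Φ t p D (gT mk gx κ Φ t p D) (fT mk fx κ Φ t p D) : ℤ) * ℓL κ Φ t p D (gT mk gx κ Φ t p D) (fT mk fx κ Φ t p D) + 1 ≤ ((nL κ Φ t p D (gT mk gx κ Φ t p D) (fT mk fx κ Φ t p D) * ℓL κ Φ t p D (gT mk gx κ Φ t p D) (fT mk fx κ Φ t p D) / shearUnit (nL κ Φ t p D (gT mk gx κ Φ t p D) (fT mk fx κ Φ t p D)) (hL κ Φ t p D (gT mk gx κ Φ t p D) (fT mk fx κ Φ t p D)) + 1 : ℕ) : ℤ) * (shearUnit (nL κ Φ t p D (gT mk gx κ Φ t p D) (fT mk fx κ Φ t p D)) (hL κ Φ t p D (gT mk gx κ Φ t p D) (fT mk fx κ Φ t p D)) : ℤ) := by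
    have hWlo' := Nat.lt_div_mul_add (a := nL κ Φ t p D (gT mk gx κ Φ t p D) (fT mk fx κ Φ t p D) * ℓL κ Φ t p D (gT mk gx κ Φ t p D) (fT mk fx κ Φ t p D)) hUpos
    have h' : nL κ Φ t p D (gT mk gx κ Φ t p D) (fT mk fx κ Φ t p D) * ℓL κ Φ t p D (gT mk gx κ Φ t p D) (fT mk fx κ Φ t p D) + 1 ≤ (nL κ Φ t p D (gT mk gx κ Φ t p D) (fT mk fx κ Φ t p D) * ℓL κ Φ t p D (gT mk gx κ Φ t p D) (fT mk fx κ Φ t p D) / shearUnit (nL κ Φ t p D (gT mk gx κ Φ t p D) (fT mk fx κ Φ t p D)) (hL κ Φ t p D (gT mk gx κ Φ t p D) (fT mk fx κ Φ t p D)) + 1) * shearUnit (nL κ Φ t p D (gT mk gx κ Φ t p D) (fT mk fx κ Φ t p D)) (hL κ Φ t p D (gT mk gx κ Φ t p D) (fT mk fx κ Φ t p D)) := by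
      rw [Nat.add_mul, one_mul]; omega
    exact_mod_cast h'
  have hab := abs_nonneg (σ * ((nL κ Φ t p D (gT mk gx κ Φ t p D) (fT mk fx κ Φ t p D) : ℤ) * a - hL κ Φ t p D (gT mk gx κ Φ t p D) (fT mk fx κ Φ t p D) * (σ * b)))
  linarith [key, h2a, h2b, hU, hfl', hWlo, abs_nonneg a]

end AtT

end KS

end NegB

end PlanarSkeletonNeg

end Summit.CriticalPhenomena.PercolationContinuityZ3.Theorems.Transplant
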